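import Literature.Analysis.FunctionSpaces.WeakLpSplit
import HarnessLib

/-!
# Weak `L^p`: quantitative truncation bounds at an arbitrary height

Analysis/FunctionSpaces proofs file (theorems only: no definitions, no named facts) over
`WeakLp.lean` / `WeakLpSplit.lean` (`Literature.Analysis.FunctionSpaces.MemWeakLp`,
`eWeakLpPow f p μ = sup_t t^p μ{‖f‖ > t}`; Grafakos, Def. 1.1.5). `WeakLpSplit.lean` proves the
*qualitative* splitting `L^{p,∞} ⊂ L^r + (L^q ∩ L^∞)` at height `1`; the compactness and energy
arguments of the Navier–Stokes theory with weak-`L³` data (Barker–Seregin–Šverák 2018, Lemma 2.1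
and (2.4)–(2.5): "`‖ḡ^N‖^{10/3}_{10/3} ≤ C N^{1/3} ‖g‖³_{L^{3,∞}}`, `‖g̃^N‖₂² ≤ C N^{-1}‖g‖³_{L^{3,∞}}`";
Bradshaw–Tsai 2017, §1: `L³_w ⊂ L²_uloc` with a bound) need the same truncation at an arbitrary
height `λ > 0` **with explicit constants**, which this file proves by the layer-cake formula
(Grafakos, proof of Thm. 1.3.2; Prop. 1.1.4), writing `W = eWeakLpPow f p μ` and `p` real:

* `MemWeakLp.lintegral_rpow_indicator_lt_norm_le` — the high part `f 𝟙_{‖f‖ > λ}` for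
  `0 < r < p`: `∫ ‖f 𝟙_{‖f‖>λ}‖^r ≤ (p/(p−r)) λ^{r−p} W`
  (`= r∫₀^λ t^{r−1} μ{‖f‖>λ} + r∫_λ^∞ t^{r−1−p} W`, `μ{‖f‖>λ} ≤ W λ^{−p}`);
* `MemWeakLp.lintegral_rpow_indicator_norm_le_le` — the low part `f 𝟙_{‖f‖ ≤ λ}` for `p < q`:
  `∫ ‖f 𝟙_{‖f‖≤λ}‖^q ≤ (q/(q−p)) λ^{q−p} W` (`= q∫₀^λ t^{q−1−p} W`, the superlevel sets above
  `λ` being empty), with `‖f 𝟙_{‖f‖≤λ}‖ ≤ λ` (`norm_indicator_norm_le_le`);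
* `MemWeakLp.lintegral_rpow_le_of_norm_le` — in particular a weak-`L^p` function bounded by `K`
  lies in `L^q`, `p < q`, with `∫‖f‖^q ≤ (q/(q−p)) K^{q−p} W` (`L^{3,∞} ∩ L^∞ ⊂ L⁴`);
* `MemWeakLp.setLIntegral_rpow_le` — local `L^r` bounds, `r < p`, on a set of finite measure:
  `∫_S ‖f‖^r ≤ μ(S) λ^r + (r/(p−r)) λ^{r−p} W` (Bradshaw–Tsai's `L³_w ⊂ L²_uloc`, quantitatively).

All four are stated for a.e.-strongly measurable `f` (the superlevel sets of a representative are
measurable and the integrals only see `f` up to null sets).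

## Mathlib / tree search

Mathlib: `lintegral_rpow_eq_lintegral_meas_lt_mul` (layer cake), `integral_rpow`,
`integral_Ioi_rpow_of_lt`, `integrableOn_Ioi_rpow_of_lt`, `ofReal_integral_eq_lintegral_ofReal`.
Tree: `meas_lt_norm_le_eWeakLpPow_mul_inv`, `ofReal_rpow_mul_meas_lt_le_eWeakLpPow`
(`WeakLpLocal.lean`), the height-one qualitative versions `MemWeakLp.memLp_indicator_one_lt_norm`,
`MemWeakLp.memLp_indicator_norm_le_one`, `MemWeakLp.setLIntegral_enorm_rpow_lt_top`, whose proofs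
are followed here with the constants kept (`lean search 'eWeakLpPow|MemWeakLp'`: no quantitative
statement in the tree).

## References

* L. Grafakos, *Classical Fourier Analysis*, 3rd ed., GTM 249 (2014), §1.1 (Prop. 1.1.4,
  Exercise 1.1.10), Thm. 1.3.2 (proof).
* T. Barker, G. Seregin, V. Šverák, Comm. PDE 43 (2018) = arXiv:1603.03211, Lemma 2.1,
  (2.4)–(2.5) [BarkerSeregin2016].
* Z. Bradshaw, T.-P. Tsai, Ann. Henri Poincaré 18 (2017) 1095–1119, §1 [BradshawTsai2017AHP].
-/

noncomputable section

open MeasureTheory Set Filter Topology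
open scoped ENNReal NNReal

namespace Literature.Analysis.FunctionSpaces

variable {α : Type*} [MeasurableSpace α] {E : Type*} [NormedAddCommGroup E]
variable {f : α → E} {p : ℝ≥0∞} {μ : Measure α}

/-! ### Two power integrals -/

/-- `∫₀^λ t^a dt = λ^{a+1}/(a+1)` for `-1 < a`, `0 < λ`, as a lower integral of `ofReal`. [folklore] -/
theorem lintegral_Ioc_ofReal_rpow {a lam : ℝ} (ha : -1 < a) (hl : 0 < lam) :
    ∫⁻ t in Ioc 0 lam, ENNReal.ofReal (t ^ a) = ENNReal.ofReal (lam ^ (a + 1) / (a + 1)) := by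
  have hint : IntervalIntegrable (fun t : ℝ => t ^ a) volume 0 lam :=
    intervalIntegral.intervalIntegrable_rpow' ha
  have hnn : 0 ≤ᵐ[volume.restrict (Ioc 0 lam)] fun t : ℝ => t ^ a := by
    filter_upwards [ae_restrict_mem measurableSet_Ioc] with t ht
    exact Real.rpow_nonneg ht.1.le _
  rw [← ofReal_integral_eq_lintegral_ofReal hint.1 hnn, ← intervalIntegral.integral_of_le hl.le,
    integral_rpow (Or.inl ha), Real.zero_rpow (by linarith), sub_zero]

/-- `∫_λ^∞ t^b dt = λ^{b+1}/(-(b+1))` for `b < -1`, `0 < λ`, as a lower integral of `ofReal`. [folklore] -/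
theorem lintegral_Ioi_ofReal_rpow {b lam : ℝ} (hb : b < -1) (hl : 0 < lam) :
    ∫⁻ t in Ioi lam, ENNReal.ofReal (t ^ b) = ENNReal.ofReal (lam ^ (b + 1) / (-(b + 1))) := by
  have hint : IntegrableOn (fun t : ℝ => t ^ b) (Ioi lam) volume := integrableOn_Ioi_rpow_of_lt hb hl
  have hnn : 0 ≤ᵐ[volume.restrict (Ioi lam)] fun t : ℝ => t ^ b := by
    filter_upwards [ae_restrict_mem measurableSet_Ioi] with t ht
    exact Real.rpow_nonneg (hl.trans ht).le _
  rw [← ofReal_integral_eq_lintegral_ofReal hint hnn, integral_Ioi_rpow_of_lt hb hl]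
  congr 1
  rw [neg_div, div_neg]

/-! ### The layer-cake set-up -/

/-- Layer cake for `‖g‖^r` as an `enorm` power. [folklore] -/
theorem lintegral_enorm_rpow_eq_layerCake {g : α → E} (hg : AEStronglyMeasurable g μ) {r : ℝ}
    (hr : 0 < r) :
    ∫⁻ x, ‖g x‖ₑ ^ r ∂μ =
      ENNReal.ofReal r * ∫⁻ t in Ioi 0, μ {a | t < ‖g a‖} * ENNReal.ofReal (t ^ (r - 1)) := by
  have hlhs : ∫⁻ x, ‖g x‖ₑ ^ r ∂μ = ∫⁻ x, ENNReal.ofReal (‖g x‖ ^ r) ∂μ :=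
    lintegral_congr fun x => by
      rw [← ofReal_norm, ENNReal.ofReal_rpow_of_nonneg (norm_nonneg _) hr.le]
  rw [hlhs]
  exact lintegral_rpow_eq_lintegral_meas_lt_mul μ (Eventually.of_forall fun x => norm_nonneg _)
    hg.norm.aemeasurable hr

/-- Splitting a lower integral over `(0, ∞)` at `λ > 0` against the two power tails. [folklore] -/
theorem lintegral_Ioi_le_of_le_indicator_add {Φ : ℝ → ℝ≥0∞} {lam : ℝ} (hl : 0 < lam)
    {A B : ℝ≥0∞} {a b : ℝ}
    (h : ∀ t ∈ Ioi (0 : ℝ), Φ t ≤ (Ioc 0 lam).indicator (fun t => A * ENNReal.ofReal (t ^ a)) t +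
      (Ioi lam).indicator (fun t => B * ENNReal.ofReal (t ^ b)) t) :
    ∫⁻ t in Ioi 0, Φ t ≤ A * (∫⁻ t in Ioc 0 lam, ENNReal.ofReal (t ^ a)) +
      B * ∫⁻ t in Ioi lam, ENNReal.ofReal (t ^ b) := by
  have hm : Measurable ((Ioc (0 : ℝ) lam).indicator fun t => A * ENNReal.ofReal (t ^ a)) :=
    (measurable_const.mul (by fun_prop)).indicator measurableSet_Ioc
  calc ∫⁻ t in Ioi 0, Φ t
      ≤ ∫⁻ t in Ioi 0, (Ioc 0 lam).indicator (fun t => A * ENNReal.ofReal (t ^ a)) t +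
          (Ioi lam).indicator (fun t => B * ENNReal.ofReal (t ^ b)) t :=
        setLIntegral_mono' measurableSet_Ioi h
    _ = (∫⁻ t in Ioc (0 : ℝ) lam, A * ENNReal.ofReal (t ^ a)) +
          ∫⁻ t in Ioi lam, B * ENNReal.ofReal (t ^ b) := by
        rw [lintegral_add_left hm, lintegral_indicator measurableSet_Ioc,
          lintegral_indicator measurableSet_Ioi, Measure.restrict_restrict measurableSet_Ioc,
          Measure.restrict_restrict measurableSet_Ioi,
          inter_eq_left.2 (Ioc_subset_Ioi_self : Ioc (0 : ℝ) lam ⊆ Ioi 0),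
          inter_eq_left.2 (Ioi_subset_Ioi hl.le : Ioi lam ⊆ Ioi 0)]
    _ = A * (∫⁻ t in Ioc 0 lam, ENNReal.ofReal (t ^ a)) +
          B * ∫⁻ t in Ioi lam, ENNReal.ofReal (t ^ b) := by
        rw [lintegral_const_mul'' _ (by fun_prop), lintegral_const_mul'' _ (by fun_prop)]

/-- The Chebyshev bound at level `t`, in the form `μ{t < ‖f‖} ≤ W · t^{-p}`. [folklore] -/
theorem meas_lt_norm_le_eWeakLpPow_mul_ofReal_rpow_neg (f : α → E) (p : ℝ≥0∞) (μ : Measure α)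
    {t : ℝ} (ht : 0 < t) :
    μ {x | t < ‖f x‖} ≤ eWeakLpPow f p μ * ENNReal.ofReal (t ^ (-p.toReal)) := by
  have h := meas_lt_norm_le_eWeakLpPow_mul_inv f p μ ht
  rwa [← ENNReal.ofReal_inv_of_pos (Real.rpow_pos_of_pos ht _), ← Real.rpow_neg ht.le] at h

/-! ### The high part `f 𝟙_{‖f‖ > λ}` -/

omit [MeasurableSpace α] in
/-- The superlevel sets of the high part `g = f 𝟙_{‖f‖ > λ}`: `{t < ‖g‖} ⊆ {λ < ‖f‖}` for
`t > 0`, and `{t < ‖g‖} ⊆ {t < ‖f‖}`. [folklore] -/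
theorem setOf_lt_norm_indicator_lt_norm_subset (f : α → E) (lam : ℝ) {t : ℝ} (ht : 0 < t) :
    {a | t < ‖{x | lam < ‖f x‖}.indicator f a‖} ⊆ {x | lam < ‖f x‖} ∩ {x | t < ‖f x‖} := by
  intro x hx
  rw [mem_setOf_eq] at hx
  by_cases hxA : x ∈ {x | lam < ‖f x‖}
  · rw [indicator_of_mem hxA] at hx
    exact ⟨hxA, hx⟩
  · rw [indicator_of_notMem hxA, norm_zero] at hx
    exact absurd hx (not_lt.2 ht.le)

/-- **The high part of a weak-`L^p` function, quantitatively** (Grafakos, proof of Thm. 1.3.2;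
Barker–Seregin–Šverák 2018, (2.5): `‖g̃^N‖₂² ≤ C N^{-1}‖g‖³_{L^{3,∞}}`): for `0 < r < p < ∞`,
`λ > 0` and `f` a.e.-strongly measurable,
`∫ ‖f 𝟙_{‖f‖>λ}‖^r dμ ≤ (p/(p−r)) λ^{r−p} · sup_t t^p μ{‖f‖>t}`. [cite: BarkerSeregin2016, Lemma 2.1 (2.5)] -/
theorem MemWeakLp.lintegral_rpow_indicator_lt_norm_le (hfm : AEStronglyMeasurable f μ) {lam : ℝ}
    (hA : MeasurableSet {x | lam < ‖f x‖}) {r : ℝ} (hr : 0 < r) (hrp : r < p.toReal)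
    (hl : 0 < lam) :
    ∫⁻ x, ‖{x | lam < ‖f x‖}.indicator f x‖ₑ ^ r ∂μ ≤
      ENNReal.ofReal (p.toReal / (p.toReal - r) * lam ^ (r - p.toReal)) * eWeakLpPow f p μ := by
  set g : α → E := {x | lam < ‖f x‖}.indicator f with hg
  set W : ℝ≥0∞ := eWeakLpPow f p μ with hW
  set P : ℝ := p.toReal with hP
  have hPr : 0 < P - r := by linarith
  have hgm : AEStronglyMeasurable g μ := hfm.indicator hA
  rw [lintegral_enorm_rpow_eq_layerCake hgm hr]
  -- pointwise bound of the layer-cake integrand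
  have hbound : ∀ t ∈ Ioi (0 : ℝ), μ {a | t < ‖g a‖} * ENNReal.ofReal (t ^ (r - 1)) ≤
      (Ioc 0 lam).indicator
          (fun t => W * ENNReal.ofReal (lam ^ (-P)) * ENNReal.ofReal (t ^ (r - 1))) t +
        (Ioi lam).indicator (fun t => W * ENNReal.ofReal (t ^ (r - 1 - P))) t := by
    intro t ht
    have ht0 : 0 < t := ht
    have hsub := setOf_lt_norm_indicator_lt_norm_subset f lam ht0
    rcases le_or_gt t lam with h1 | h1
    · rw [indicator_of_mem (mem_Ioc.2 ⟨ht0, h1⟩)]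
      refine le_add_right (mul_le_mul' ?_ le_rfl)
      exact (measure_mono (hsub.trans inter_subset_left)).trans
        (meas_lt_norm_le_eWeakLpPow_mul_ofReal_rpow_neg f p μ hl)
    · rw [indicator_of_mem (mem_Ioi.2 h1)]
      refine le_add_left ?_
      calc μ {a | t < ‖g a‖} * ENNReal.ofReal (t ^ (r - 1))
          ≤ W * ENNReal.ofReal (t ^ (-P)) * ENNReal.ofReal (t ^ (r - 1)) :=
            mul_le_mul' ((measure_mono (hsub.trans inter_subset_right)).trans
              (meas_lt_norm_le_eWeakLpPow_mul_ofReal_rpow_neg f p μ ht0)) le_rfl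
        _ = W * ENNReal.ofReal (t ^ (r - 1 - P)) := by
            rw [mul_assoc, ← ENNReal.ofReal_mul (Real.rpow_nonneg ht0.le _), ← Real.rpow_add ht0]
            congr 3
            ring
  refine (mul_le_mul' le_rfl (lintegral_Ioi_le_of_le_indicator_add hl hbound)).trans ?_
  rw [lintegral_Ioc_ofReal_rpow (by linarith) hl, lintegral_Ioi_ofReal_rpow (by linarith) hl]
  -- arithmetic
  have e1 : r - 1 + 1 = r := by ring
  have e2 : r - 1 - P + 1 = r - P := by ring
  have e3 : -(r - P) = P - r := by ring
  rw [e1, e2, e3]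
  have hlr : 0 < lam ^ r := Real.rpow_pos_of_pos hl _
  have hlP : 0 < lam ^ (-P) := Real.rpow_pos_of_pos hl _
  have hlrP : 0 < lam ^ (r - P) := Real.rpow_pos_of_pos hl _
  have hkey : ENNReal.ofReal r * (W * ENNReal.ofReal (lam ^ (-P)) * ENNReal.ofReal (lam ^ r / r) +
      W * ENNReal.ofReal (lam ^ (r - P) / (P - r))) =
      ENNReal.ofReal (P / (P - r) * lam ^ (r - P)) * W := by
    have hprod : lam ^ (-P) * (lam ^ r / r) = lam ^ (r - P) / r := by
      rw [mul_div_assoc', ← Real.rpow_add hl]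
      congr 1
      ring_nf
    calc ENNReal.ofReal r * (W * ENNReal.ofReal (lam ^ (-P)) * ENNReal.ofReal (lam ^ r / r) +
          W * ENNReal.ofReal (lam ^ (r - P) / (P - r)))
        = W * (ENNReal.ofReal r * (ENNReal.ofReal (lam ^ (-P)) * ENNReal.ofReal (lam ^ r / r) +
            ENNReal.ofReal (lam ^ (r - P) / (P - r)))) := by ring
      _ = W * ENNReal.ofReal (r * (lam ^ (-P) * (lam ^ r / r) + lam ^ (r - P) / (P - r))) := by
          rw [← ENNReal.ofReal_mul hlP.le, ← ENNReal.ofReal_add (by positivity) (by positivity),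
            ← ENNReal.ofReal_mul hr.le]
      _ = W * ENNReal.ofReal (P / (P - r) * lam ^ (r - P)) := by
          congr 2
          rw [hprod]
          field_simp
          ring
      _ = ENNReal.ofReal (P / (P - r) * lam ^ (r - P)) * W := mul_comm _ _
  exact hkey.le

/-! ### The low part `f 𝟙_{‖f‖ ≤ λ}` -/

omit [MeasurableSpace α] in
/-- The low part is bounded by `λ` (for `0 ≤ λ`). [folklore] -/
theorem norm_indicator_norm_le_le (f : α → E) {lam : ℝ} (hl : 0 ≤ lam) (x : α) :
    ‖{x | ‖f x‖ ≤ lam}.indicator f x‖ ≤ lam := by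
  by_cases hx : x ∈ {x | ‖f x‖ ≤ lam}
  · rw [indicator_of_mem hx]; exact hx
  · rw [indicator_of_notMem hx, norm_zero]; exact hl

omit [MeasurableSpace α] in
/-- The two truncations at height `λ` recompose `f`. [folklore] -/
theorem indicator_lt_norm_add_indicator_norm_le (f : α → E) (lam : ℝ) :
    {x | lam < ‖f x‖}.indicator f + {x | ‖f x‖ ≤ lam}.indicator f = f := by
  have h : {x | ‖f x‖ ≤ lam} = {x | lam < ‖f x‖}ᶜ := by
    ext x; simp
  rw [h]
  exact indicator_self_add_compl _ _

/-- **The low part of a weak-`L^p` function, quantitatively** (Grafakos, proof of Thm. 1.3.2;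
Barker–Seregin–Šverák 2018, (2.4): `‖ḡ^N‖^{10/3}_{10/3} ≤ C N^{1/3}‖g‖³_{L^{3,∞}}`): for
`p < q < ∞`, `λ > 0` and `f` a.e.-strongly measurable,
`∫ ‖f 𝟙_{‖f‖≤λ}‖^q dμ ≤ (q/(q−p)) λ^{q−p} · sup_t t^p μ{‖f‖>t}`. [cite: BarkerSeregin2016, Lemma 2.1 (2.4)] -/
theorem MemWeakLp.lintegral_rpow_indicator_norm_le_le (hfm : AEStronglyMeasurable f μ) {lam : ℝ}
    (hB : MeasurableSet {x | ‖f x‖ ≤ lam}) {q : ℝ} (hpq : p.toReal < q) (hl : 0 < lam) :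
    ∫⁻ x, ‖{x | ‖f x‖ ≤ lam}.indicator f x‖ₑ ^ q ∂μ ≤
      ENNReal.ofReal (q / (q - p.toReal) * lam ^ (q - p.toReal)) * eWeakLpPow f p μ := by
  set h : α → E := {x | ‖f x‖ ≤ lam}.indicator f with hh
  set W : ℝ≥0∞ := eWeakLpPow f p μ with hW
  set P : ℝ := p.toReal with hP
  have hP0 : 0 ≤ P := ENNReal.toReal_nonneg
  have hq : 0 < q := lt_of_le_of_lt hP0 hpq
  have hqP : 0 < q - P := by linarith
  have hhm : AEStronglyMeasurable h μ := hfm.indicator hB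
  rw [lintegral_enorm_rpow_eq_layerCake hhm hq]
  have hbound : ∀ t ∈ Ioi (0 : ℝ), μ {a | t < ‖h a‖} * ENNReal.ofReal (t ^ (q - 1)) ≤
      (Ioc 0 lam).indicator (fun t => W * ENNReal.ofReal (t ^ (q - 1 - P))) t +
        (Ioi lam).indicator (fun t => 0 * ENNReal.ofReal (t ^ (-2 : ℝ))) t := by
    intro t ht
    have ht0 : 0 < t := ht
    rcases le_or_gt t lam with h1 | h1
    · rw [indicator_of_mem (mem_Ioc.2 ⟨ht0, h1⟩)]
      refine le_add_right ?_
      have hsubf : {a | t < ‖h a‖} ⊆ {x | t < ‖f x‖} := by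
        intro x hx
        rw [mem_setOf_eq] at hx
        by_cases hxB : x ∈ {x | ‖f x‖ ≤ lam}
        · rw [hh, indicator_of_mem hxB] at hx; exact hx
        · rw [hh, indicator_of_notMem hxB, norm_zero] at hx
          exact absurd hx (not_lt.2 ht0.le)
      calc μ {a | t < ‖h a‖} * ENNReal.ofReal (t ^ (q - 1))
          ≤ W * ENNReal.ofReal (t ^ (-P)) * ENNReal.ofReal (t ^ (q - 1)) :=
            mul_le_mul' ((measure_mono hsubf).trans
              (meas_lt_norm_le_eWeakLpPow_mul_ofReal_rpow_neg f p μ ht0)) le_rfl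
        _ = W * ENNReal.ofReal (t ^ (q - 1 - P)) := by
            rw [mul_assoc, ← ENNReal.ofReal_mul (Real.rpow_nonneg ht0.le _), ← Real.rpow_add ht0]
            congr 3
            ring
    · rw [indicator_of_mem (mem_Ioi.2 h1)]
      refine le_add_left ?_
      have hempty : {a | t < ‖h a‖} = ∅ := by
        refine eq_empty_iff_forall_notMem.2 fun x hx => ?_
        rw [mem_setOf_eq] at hx
        exact absurd ((norm_indicator_norm_le_le f hl.le x).trans_lt h1) (not_lt.2 hx.le)
      rw [hempty, measure_empty, zero_mul]
      exact zero_le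
  refine (mul_le_mul' le_rfl (lintegral_Ioi_le_of_le_indicator_add hl hbound)).trans ?_
  rw [zero_mul, add_zero, lintegral_Ioc_ofReal_rpow (by linarith) hl]
  have e2 : q - 1 - P + 1 = q - P := by ring
  rw [e2]
  have hlqP : 0 < lam ^ (q - P) := Real.rpow_pos_of_pos hl _
  have hkey : ENNReal.ofReal q * (W * ENNReal.ofReal (lam ^ (q - P) / (q - P))) =
      ENNReal.ofReal (q / (q - P) * lam ^ (q - P)) * W := by
    calc ENNReal.ofReal q * (W * ENNReal.ofReal (lam ^ (q - P) / (q - P)))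
        = W * (ENNReal.ofReal q * ENNReal.ofReal (lam ^ (q - P) / (q - P))) := by ring
      _ = W * ENNReal.ofReal (q / (q - P) * lam ^ (q - P)) := by
          rw [← ENNReal.ofReal_mul hq.le]
          congr 2
          field_simp
      _ = ENNReal.ofReal (q / (q - P) * lam ^ (q - P)) * W := mul_comm _ _
  exact hkey.le

/-- **A bounded weak-`L^p` function lies in `L^q` for `p < q`, quantitatively**: if `‖f‖ ≤ K`
everywhere, `0 < K`, then `∫ ‖f‖^q dμ ≤ (q/(q−p)) K^{q−p} · sup_t t^p μ{‖f‖>t}` (the case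
`λ = K` of the low part, where `f 𝟙_{‖f‖≤K} = f`; e.g. `L^{3,∞} ∩ L^∞ ⊂ L⁴`). [folklore] -/
theorem MemWeakLp.lintegral_rpow_le_of_norm_le (hfm : AEStronglyMeasurable f μ) {K : ℝ}
    (hK : 0 < K) (hfK : ∀ x, ‖f x‖ ≤ K) {q : ℝ} (hpq : p.toReal < q) :
    ∫⁻ x, ‖f x‖ₑ ^ q ∂μ ≤
      ENNReal.ofReal (q / (q - p.toReal) * K ^ (q - p.toReal)) * eWeakLpPow f p μ := by
  have hB : {x | ‖f x‖ ≤ K} = univ := eq_univ_of_forall fun x => hfK x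
  have hind : {x | ‖f x‖ ≤ K}.indicator f = f := by rw [hB, indicator_univ]
  have h := MemWeakLp.lintegral_rpow_indicator_norm_le_le (μ := μ) hfm
    (by rw [hB]; exact MeasurableSet.univ) hpq hK
  rwa [hind] at h

/-- **`L^{p,∞} ∩ L^∞ ⊂ L^q` for `p < q < ∞`** (membership form of
`MemWeakLp.lintegral_rpow_le_of_norm_le`). [folklore] -/
theorem MemWeakLp.memLp_of_norm_le (hf : MemWeakLp f p μ) {K : ℝ} (hK : 0 < K)
    (hfK : ∀ x, ‖f x‖ ≤ K) {q : ℝ≥0∞} (hpq : p < q) (hq : q ≠ ∞) :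
    MemLp f q μ := by
  have hp : p ≠ ∞ := (hpq.trans_le le_top).ne
  have hq0 : q ≠ 0 := (lt_of_le_of_lt bot_le hpq).ne'
  have hpq' : p.toReal < q.toReal := (ENNReal.toReal_lt_toReal hp hq).2 hpq
  refine ⟨hf.1, ?_⟩
  rw [eLpNorm_lt_top_iff_lintegral_rpow_enorm_lt_top hq0 hq]
  refine lt_of_le_of_lt (MemWeakLp.lintegral_rpow_le_of_norm_le hf.1 hK hfK hpq') ?_
  exact ENNReal.mul_lt_top ENNReal.ofReal_lt_top hf.2

/-! ### Local `L^r` bounds, `r < p` -/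

/-- **Weak `L^p` is locally `L^r` for `r < p`, quantitatively** (Grafakos, §1.1, Exercise 1.1.11;
Bradshaw–Tsai 2017, §1: `L³_w(ℝ³) ⊂ L²_uloc(ℝ³)`): for `0 < r < p < ∞`, `μ(S) < ∞`, `λ > 0` and
`f` a.e.-strongly measurable,
`∫_S ‖f‖^r dμ ≤ μ(S) λ^r + (r/(p−r)) λ^{r−p} · sup_t t^p μ{‖f‖>t}` (of interest when `μ(S) < ∞`). [cite: BradshawTsai2017AHP, §1 (L^3_w ⊂ L^2_uloc)] -/
theorem MemWeakLp.setLIntegral_rpow_le (hfm : AEStronglyMeasurable f μ) {r : ℝ}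
    (hr : 0 < r) (hrp : r < p.toReal) (S : Set α) {lam : ℝ} (hl : 0 < lam) :
    ∫⁻ x in S, ‖f x‖ₑ ^ r ∂μ ≤ μ S * ENNReal.ofReal (lam ^ r) +
      ENNReal.ofReal (r / (p.toReal - r) * lam ^ (r - p.toReal)) * eWeakLpPow f p μ := by
  set W : ℝ≥0∞ := eWeakLpPow f p μ with hW
  set P : ℝ := p.toReal with hP
  have hPr : 0 < P - r := by linarith
  rw [lintegral_enorm_rpow_eq_layerCake hfm.restrict hr]
  have hbound : ∀ t ∈ Ioi (0 : ℝ),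
      (μ.restrict S) {a | t < ‖f a‖} * ENNReal.ofReal (t ^ (r - 1)) ≤
        (Ioc 0 lam).indicator (fun t => μ S * ENNReal.ofReal (t ^ (r - 1))) t +
          (Ioi lam).indicator (fun t => W * ENNReal.ofReal (t ^ (r - 1 - P))) t := by
    intro t ht
    have ht0 : 0 < t := ht
    rcases le_or_gt t lam with h1 | h1
    · rw [indicator_of_mem (mem_Ioc.2 ⟨ht0, h1⟩)]
      refine le_add_right (mul_le_mul' ?_ le_rfl)
      calc (μ.restrict S) {a | t < ‖f a‖} ≤ (μ.restrict S) univ := measure_mono (subset_univ _)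
        _ = μ S := Measure.restrict_apply_univ _
    · rw [indicator_of_mem (mem_Ioi.2 h1)]
      refine le_add_left ?_
      have h2 : (μ.restrict S) {a | t < ‖f a‖} ≤ W * ENNReal.ofReal (t ^ (-P)) :=
        (Measure.le_iff'.1 Measure.restrict_le_self _).trans
          (meas_lt_norm_le_eWeakLpPow_mul_ofReal_rpow_neg f p μ ht0)
      calc (μ.restrict S) {a | t < ‖f a‖} * ENNReal.ofReal (t ^ (r - 1))
          ≤ W * ENNReal.ofReal (t ^ (-P)) * ENNReal.ofReal (t ^ (r - 1)) := mul_le_mul' h2 le_rfl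
        _ = W * ENNReal.ofReal (t ^ (r - 1 - P)) := by
            rw [mul_assoc, ← ENNReal.ofReal_mul (Real.rpow_nonneg ht0.le _), ← Real.rpow_add ht0]
            congr 3
            ring
  refine (mul_le_mul' le_rfl (lintegral_Ioi_le_of_le_indicator_add hl hbound)).trans ?_
  rw [lintegral_Ioc_ofReal_rpow (by linarith) hl, lintegral_Ioi_ofReal_rpow (by linarith) hl]
  have e1 : r - 1 + 1 = r := by ring
  have e2 : r - 1 - P + 1 = r - P := by ring
  have e3 : -(r - P) = P - r := by ring
  rw [e1, e2, e3]
  have hlr : 0 < lam ^ r := Real.rpow_pos_of_pos hl _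
  have hlrP : 0 < lam ^ (r - P) := Real.rpow_pos_of_pos hl _
  have hkey : ENNReal.ofReal r * (μ S * ENNReal.ofReal (lam ^ r / r) +
      W * ENNReal.ofReal (lam ^ (r - P) / (P - r))) =
      μ S * ENNReal.ofReal (lam ^ r) + ENNReal.ofReal (r / (P - r) * lam ^ (r - P)) * W := by
    have h1 : ENNReal.ofReal r * ENNReal.ofReal (lam ^ r / r) = ENNReal.ofReal (lam ^ r) := by
      rw [← ENNReal.ofReal_mul hr.le]
      congr 1
      field_simp
    have h2 : ENNReal.ofReal r * ENNReal.ofReal (lam ^ (r - P) / (P - r)) =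
        ENNReal.ofReal (r / (P - r) * lam ^ (r - P)) := by
      rw [← ENNReal.ofReal_mul hr.le]
      congr 1
      field_simp
    calc ENNReal.ofReal r * (μ S * ENNReal.ofReal (lam ^ r / r) +
          W * ENNReal.ofReal (lam ^ (r - P) / (P - r)))
        = μ S * (ENNReal.ofReal r * ENNReal.ofReal (lam ^ r / r)) +
            (ENNReal.ofReal r * ENNReal.ofReal (lam ^ (r - P) / (P - r))) * W := by ring
      _ = μ S * ENNReal.ofReal (lam ^ r) + ENNReal.ofReal (r / (P - r) * lam ^ (r - P)) * W := by
          rw [h1, h2]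
  exact hkey.le

/-- **`L^{3,∞} ⊂ L²_loc` with the bound at height one** (Bradshaw–Tsai 2017, §1): for `f` weak-`L³`
(a.e.-strongly measurable, on any measure space) and any `S`,
`∫_S ‖f‖² ≤ μ(S) + 2 · sup_t t³ μ{‖f‖>t}` (the case `p = 3`, `r = 2`, `λ = 1` of
`MemWeakLp.setLIntegral_rpow_le`, with the square as a natural power). [cite: BradshawTsai2017AHP, §1 (L^3_w ⊂ L^2_uloc)] -/
theorem MemWeakLp.setLIntegral_enorm_sq_le_of_three (hf : AEStronglyMeasurable f μ) (S : Set α) :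
    ∫⁻ x in S, ‖f x‖ₑ ^ 2 ∂μ ≤ μ S + 2 * eWeakLpPow f 3 μ := by
  have h := MemWeakLp.setLIntegral_rpow_le (p := 3) (μ := μ) hf
    (r := 2) zero_lt_two (by rw [ENNReal.toReal_ofNat]; norm_num) S zero_lt_one
  simp only [ENNReal.toReal_ofNat, Real.one_rpow, ENNReal.ofReal_one, mul_one] at h
  have e : ENNReal.ofReal (2 / (3 - 2)) = 2 := by norm_num
  rw [e] at h
  have hlhs : ∫⁻ x in S, ‖f x‖ₑ ^ 2 ∂μ = ∫⁻ x in S, ‖f x‖ₑ ^ (2 : ℝ) ∂μ :=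
    lintegral_congr fun x => by rw [← ENNReal.rpow_natCast]; norm_num
  rw [hlhs]
  exact h

end Literature.Analysis.FunctionSpaces

end
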